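import Summits.BirchSwinnertonDyer.BirchSwinnertonDyer.Theorems.PrintCf2RubinValueTwoKatzFrameSupply
import Summits.BirchSwinnertonDyer.BirchSwinnertonDyer.Theorems.PrintCf2RubinValueTwoKatzPeriodNormRigidity
import HarnessLib

set_option linter.dupNamespace false
set_option autoImplicit false

/-!
# TWO-VARIABLE KATZ PERIOD RIGIDITY AT THE TRIVIAL CHARACTER (every prime `p`): two frames of one branch at two period triples take
# values at the ORIGIN of the polydisc — a point OFF de Shalit's interpolation range — related EXACTLY by `G'(0,0) = A^{a+b}·B^{b}·G(0,0)`

Cell `bsd-print-cf2`, width seat `bsd-line-cf2c-w3` g4, route C `PrintCf2RubinValueTwo`, `--supports stmt-BirchSwinnertonDyer-23722`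
(the «(R) period-rigidity» aside).  Theses-free; THEOREMS ONLY (no `def`, no named fact, no `sorry`); nothing is closed; BSD is not proved by
any of this; no summit statement is proved by this seat.

The norm half of (R) (`KatzPeriodRigidity.norm_periodRatio_eq_one`: `‖A‖ = ‖B‖ = 1` for `A = ι⁻¹(Ω/Ω')·(Ω_p'/Ω_p)`, `B = ι⁻¹(δ/δ')`) speaks about
the period ratios; this file is the first EXACT off-range statement: **`value_origin_eq_periodRatio_pow_mul`** — on B18's binder list (twist `λ`
of type `(−a, b)`), if `G ≠ 0` and `G'` solve the frames of one branch at `(Ω, δ, Ω_p)` and `(Ω', δ', Ω_p')`, then their values `g, g'` at the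
origin `(0,0)` (the trivial character of `Γ`; for `λ` of finite order the point `m = j = 0`, never in the cone `j < m`) satisfy
`g' = A^{a+b}·B^{b}·g`; hence `‖g'‖ = ‖g‖` (`norm_value_origin_eq`).  Mechanism (the `p`-adic-continuity step of the (R) roadmap's L1): on a
supply line with a non-zero node (it exists since `G ≠ 0`; `exists_frameSupply₂`) the node values satisfy `y_t = c_s·D_s^t·x_t` with `D_s` a
principal unit (`norm_sub_one_lt_one_of_values_mul_pow_succ`), and along `t + 1 = pᵏ` the nodes `u_s^{pᵏ} − 1` tend to the origin while
`D_s^{pᵏ} → 1`, so the values at `T = 0` of the two monomial lines — the values of `G, G'` at `(0,0)` — differ by `c_s/D_s = A^{a+b}B^{b}`.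
For the S2′ frame of road α (twist `θK⁻¹`, seed `η`) the same statement read through the unit twist is the exact relation at the SEED POINT
`(e(γ₁⁻¹) − 1, e(γ₂⁻¹) − 1)`; the FRAME POINT of S2′ stays out of reach of continuity (it is 2-adically isolated from the range — memo
`Cruxes/RestrictedMainConjWithValueAtTwo/R-PERIOD-RIGIDITY-cf2c-w3g4.md` §3).

References: [deShalit1987] II.4.12 Remarks (iii)–(iv) (p. 66–67), II.4.16 (49)–(50), II.4.17 (52)–(54) (p. 77–78); [Washington1997] §5.1–§5.2.
-/

noncomputable section

open scoped NumberField Classical Topology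
open Filter NumberField IsDedekindDomain Field
open Literature Literature.NumberTheory.GaloisRepresentations Literature.NumberTheory.EllipticCurves
open Summit.BirchSwinnertonDyer.Rank1Residual.X11b Summit.BirchSwinnertonDyer.BirchSwinnertonDyer.Theorems.PrintCf2
  Summit.BirchSwinnertonDyer.BirchSwinnertonDyer.Theorems.CycTangentCMCycTangentBoundPeriodRigidity

namespace Summit.BirchSwinnertonDyer.BirchSwinnertonDyer.Theorems.PrintCf2.KatzPeriodRigidity

variable {p : ℕ} [Fact p.Prime] {K : Type} [Field K] [NumberField K]

/-- **EXACT PERIOD RIGIDITY AT THE ORIGIN.** On B18's binder list: two solutions `G ≠ 0`, `G'` of de Shalit's frames of ONE branch at period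
triples `(Ω, δ, Ω_p)`, `(Ω', δ', Ω_p')` (all non-zero) take values `g, g'` at the origin of the polydisc with `g' = A^{a+b}·B^{b}·g`,
`A = ι⁻¹(Ω/Ω')·(Ω_p'/Ω_p)`, `B = ι⁻¹(δ/δ')`, `(−a, b)` the type of `λ`. [cite: deShalit1987, II.4.12 Remarks (iii)–(iv) (p. 66–67), II.4.17 (52)–(54) (p. 77–78)]
[cite: Washington1997, §5.1–§5.2] -/
theorem value_origin_eq_periodRatio_pow_mul (hK : IsImaginaryQuadratic K)
    {ι : PadicAlgCl p ≃+* ℂ} {v vbar : HeightOneSpectrum (𝓞 K)}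
    (hv : ((p : ℕ) : 𝓞 K) ∈ v.asIdeal) (hvbar : ((p : ℕ) : 𝓞 K) ∈ vbar.asIdeal) (hne : vbar ≠ v)
    (hι : ∀ (w : InfinitePlace K) (d : 𝓞 K), d ∈ v.asIdeal ↔ ‖ι.symm (w.embedding (d : K))‖ < 1)
    {S : Finset (HeightOneSpectrum (𝓞 K))}
    {η : HeckeCharacter K} {w₀ : ℕ} (hw₀ : 0 < w₀) (hη : η.HasInfinityType (fun _ ↦ (w₀ : ℤ)) (fun _ ↦ 0))
    {lam : HeckeCharacter K} {a b : ℕ} (hba : b ≤ a)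
    (hlam : lam.HasInfinityType (fun _ ↦ -(a : ℤ)) (fun _ ↦ (b : ℤ)))
    (hlamu : ∀ w : HeightOneSpectrum (𝓞 K), w ∉ S → w ≠ vbar → lam.IsUnramifiedAt w)
    {κ₁ κ₂ : ZpExtension K p} {γ₁ γ₂ : absoluteGaloisGroup K}
    (hpair : ZpExtension.IsTopGeneratorPair κ₁ κ₂ γ₁ γ₂)
    {Ω δ Ω' δ' : ℂ} {Ωp Ωp' : ℂ_[p]} {G G' : PowerSeries (PowerSeries (PadicComplexInt p))}
    (hG : IsKatzMeasure₂ ι v vbar S κ₁ κ₂ γ₁ γ₂ lam Ω δ Ωp G)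
    (hG' : IsKatzMeasure₂ ι v vbar S κ₁ κ₂ γ₁ γ₂ lam Ω' δ' Ωp' G')
    (hΩ : Ω ≠ 0) (hδ : δ ≠ 0) (hΩp : Ωp ≠ 0) (hΩ' : Ω' ≠ 0) (hδ' : δ' ≠ 0) (hΩp' : Ωp' ≠ 0)
    (hG0 : G ≠ 0) {g g' : ℂ_[p]} (hg : IntSeries.HasValueAt₂ G 0 0 g) (hg' : IntSeries.HasValueAt₂ G' 0 0 g') :
    g' = ((((ι.symm (Ω / Ω')) : PadicAlgCl p) : ℂ_[p]) * (Ωp' / Ωp)) ^ (a + b) *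
      (((ι.symm (δ / δ')) : PadicAlgCl p) : ℂ_[p]) ^ b * g := by
  have hp : p.Prime := Fact.out
  obtain ⟨κF, γF, ρ, r, u, N, W, aF, hN, hWpos, haF, hκpair, hγ, hc₂, hprop, husmall, hune, hsup⟩ :=
    exists_frameSupply₂ hK hv hvbar hne hι hw₀ hη hba hlam hlamu hpair
  have hu1 : ∀ s, ‖u s - 1‖ < 1 := fun s ↦ (husmall s).trans_le norm_prime_padicComplex_lt_one.le
  set m : ℕ → ℕ → ℕ := fun s t ↦ a + N * (W * (aF s * (t + 1))) with hmdef
  set j : ℕ → ℕ → ℕ := fun s t ↦ b + N * (W * (t + 1)) with hjdef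
  have hL : ∀ s t, LFunction.HasEntireContinuation (heckeLFunction (lam * ρ s t)) := fun s t ↦ (hsup s t).2.2.2.2.2.2
  -- the monomial lines and their node values
  set F : ℕ → PowerSeries (PadicComplexInt p) := fun s ↦
    IntSeries.monomialLine (Multiplicative.toAdd (κF s γ₁)) (Multiplicative.toAdd (κF s γ₂)) G with hFdef
  set F' : ℕ → PowerSeries (PadicComplexInt p) := fun s ↦
    IntSeries.monomialLine (Multiplicative.toAdd (κF s γ₁)) (Multiplicative.toAdd (κF s γ₂)) G' with hF'def
  have hFbr : ∀ s, DeShalit1987.IsKatzBranch ι v vbar S (κF s) (γF s) lam Ω δ Ωp (F s) :=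
    fun s ↦ hG.isKatzBranch_monomialLine (hκpair s) (hγ s)
  have hF'br : ∀ s, DeShalit1987.IsKatzBranch ι v vbar S (κF s) (γF s) lam Ω' δ' Ωp' (F' s) :=
    fun s ↦ hG'.isKatzBranch_monomialLine (hκpair s) (hγ s)
  set x : ℕ → ℕ → ℂ_[p] := fun s t ↦
    (((ι.symm (DeShalit1987.interpolationValue p v vbar S (lam * ρ s t) (m s t) (j s t) Ω δ
      ((hL s t).continuation 0))) : PadicAlgCl p) : ℂ_[p]) * Ωp ^ (m s t + j s t) with hxdef
  set y : ℕ → ℕ → ℂ_[p] := fun s t ↦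
    (((ι.symm (DeShalit1987.interpolationValue p v vbar S (lam * ρ s t) (m s t) (j s t) Ω' δ'
      ((hL s t).continuation 0))) : PadicAlgCl p) : ℂ_[p]) * Ωp' ^ (m s t + j s t) with hydef
  have hxF : ∀ s t, IntSeries.HasValueAt (F s) (u s ^ (t + 1) - 1) (x s t) := fun s t ↦ by
    obtain ⟨hr, hκr, hrval, hinf, hjm, hunr, -⟩ := hsup s t
    rw [← hrval]
    exact hFbr s (ρ s t) (r s t) (m s t) (j s t) hr hκr hjm hinf hunr (hL s t)
  have hyF : ∀ s t, IntSeries.HasValueAt (F' s) (u s ^ (t + 1) - 1) (y s t) := fun s t ↦ by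
    obtain ⟨hr, hκr, hrval, hinf, hjm, hunr, -⟩ := hsup s t
    rw [← hrval]
    exact hF'br s (ρ s t) (r s t) (m s t) (j s t) hr hκr hjm hinf hunr (hL s t)
  -- the period ratios and the node law `y = c_s · D_s^t · x`
  set A : ℂ_[p] := (((ι.symm (Ω / Ω')) : PadicAlgCl p) : ℂ_[p]) * (Ωp' / Ωp) with hAdef
  set B : ℂ_[p] := (((ι.symm (δ / δ')) : PadicAlgCl p) : ℂ_[p]) with hBdef
  have hιne : ∀ z : ℂ, z ≠ 0 → (((ι.symm z) : PadicAlgCl p) : ℂ_[p]) ≠ 0 := fun z hz ↦ by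
    rw [PadicComplex.coe_eq, map_ne_zero_iff _ (algebraMap (PadicAlgCl p) ℂ_[p]).injective,
      map_ne_zero_iff _ ι.symm.injective]
    exact hz
  have hA0 : A ≠ 0 := mul_ne_zero (hιne _ (div_ne_zero hΩ hΩ')) (div_ne_zero hΩp' hΩp)
  have hB0 : B ≠ 0 := hιne _ (div_ne_zero hδ hδ')
  set c : ℕ → ℂ_[p] := fun s ↦ A ^ (a + b + N * (W * (aF s + 1))) * B ^ (b + N * W) with hcdef
  set D : ℕ → ℂ_[p] := fun s ↦ A ^ (N * (W * (aF s + 1))) * B ^ (N * W) with hDdef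
  have hc0 : ∀ s, c s ≠ 0 := fun s ↦ mul_ne_zero (pow_ne_zero _ hA0) (pow_ne_zero _ hB0)
  have hD0 : ∀ s, D s ≠ 0 := fun s ↦ mul_ne_zero (pow_ne_zero _ hA0) (pow_ne_zero _ hB0)
  have hcD : ∀ s, c s * (D s)⁻¹ = A ^ (a + b) * B ^ b := fun s ↦ by
    rw [mul_inv_eq_iff_eq_mul₀ (hD0 s), hcdef, hDdef]
    ring
  have hxy : ∀ s t, y s t = c s * D s ^ t * x s t := by
    intro s t
    rw [hydef, hxdef]
    simp only
    rw [padicValue_eq_periodRatio_pow_mul ι v vbar S _ (m s t) (j s t) Ω' δ' _ Ωp' hΩ hδ hΩp, ← hAdef, ← hBdef,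
      hmdef, hjdef]
    simp only
    rw [hcdef, hDdef]
    ring
  -- a line with a non-zero node (else `G = 0`)
  have hzero : ∀ s, (∀ t, x s t = 0) → F s = 0 := fun s hs ↦
    eq_zero_of_hasValueAt_nodes_zero (F s) (hune s) (husmall s) fun t ↦ by simpa only [hs t] using hxF s t
  obtain ⟨s, t₀, h0⟩ : ∃ s t, x s t ≠ 0 := by
    by_contra hall
    push Not at hall
    exact hG0 (IntSeries.eq_zero_of_monomialLine_eq_zero G (fun s ↦ Multiplicative.toAdd (κF s γ₁))
      (fun s ↦ Multiplicative.toAdd (κF s γ₂)) hc₂ hprop fun s ↦ hzero s (hall s))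
  have hunit : ‖D s - 1‖ < 1 :=
    norm_sub_one_lt_one_of_values_mul_pow_succ (F s) (F' s) (hu1 s) (hc0 s) (hD0 s) (hxF s) (hyF s) (hxy s) h0
  -- along `t + 1 = pᵏ`: nodes → 0, `D_s^{pᵏ} → 1`
  set tk : ℕ → ℕ := fun k ↦ p ^ k - 1 with htk
  have htk1 : ∀ k, tk k + 1 = p ^ k := fun k ↦ Nat.sub_add_cancel (Nat.one_le_pow _ _ hp.pos)
  have hnode : Tendsto (fun k ↦ u s ^ (tk k + 1) - 1) atTop (𝓝 0) := by
    have h := (tendsto_pow_prime_pow_padicComplex (hu1 s)).sub_const 1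
    rw [sub_self] at h
    exact h.congr fun k ↦ by rw [htk1]
  have hx0 : IntSeries.HasValueAt (F s) 0 ((PowerSeries.constantCoeff (F s) : PadicComplexInt p) : ℂ_[p]) :=
    IntSeries.hasValueAt_zero _
  have hy0 : IntSeries.HasValueAt (F' s) 0 ((PowerSeries.constantCoeff (F' s) : PadicComplexInt p) : ℂ_[p]) :=
    IntSeries.hasValueAt_zero _
  have hxlim : Tendsto (fun k ↦ x s (tk k)) atTop (𝓝 ((PowerSeries.constantCoeff (F s) : PadicComplexInt p) : ℂ_[p])) :=
    tendsto_value (fun k ↦ norm_pow_sub_one_lt_one (hu1 s) _) (by rw [norm_zero]; exact one_pos)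
      (fun k ↦ hxF s (tk k)) hx0 hnode
  have hylim : Tendsto (fun k ↦ y s (tk k)) atTop (𝓝 ((PowerSeries.constantCoeff (F' s) : PadicComplexInt p) : ℂ_[p])) :=
    tendsto_value (fun k ↦ norm_pow_sub_one_lt_one (hu1 s) _) (by rw [norm_zero]; exact one_pos)
      (fun k ↦ hyF s (tk k)) hy0 hnode
  have hDlim : Tendsto (fun k ↦ D s ^ p ^ k) atTop (𝓝 1) := tendsto_pow_prime_pow_padicComplex hunit
  have hylim' : Tendsto (fun k ↦ y s (tk k)) atTop
      (𝓝 (c s * (D s)⁻¹ * 1 * ((PowerSeries.constantCoeff (F s) : PadicComplexInt p) : ℂ_[p]))) := by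
    have h := ((hDlim.const_mul (c s * (D s)⁻¹)).mul hxlim)
    refine h.congr fun k ↦ ?_
    show c s * (D s)⁻¹ * D s ^ p ^ k * x s (tk k) = y s (tk k)
    rw [hxy s (tk k), ← htk1 k, pow_succ]
    have hDs := hD0 s
    field_simp
  have hkey := tendsto_nhds_unique hylim hylim'
  rw [mul_one, hcD s] at hkey
  -- the values at the origin are the values of the lines at `T = 0`
  have h1 : ∀ c₀ : ℤ_[p], IntSeries.onePlusPow c₀ (0 : ℂ_[p]) - 1 = 0 := fun c₀ ↦ by
    have h := IntSeries.norm_onePlusPow_sub_one_le c₀ (x := (0 : ℂ_[p])) (by rw [norm_zero]; exact one_pos)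
    rw [norm_zero] at h
    exact norm_le_zero_iff.mp h
  have hgF : IntSeries.HasValueAt (F s) 0 g := by
    rw [hFdef, IntSeries.hasValueAt_monomialLine_iff _ _ G (by rw [norm_zero]; exact one_pos), h1, h1]
    exact hg
  have hg'F : IntSeries.HasValueAt (F' s) 0 g' := by
    rw [hF'def, IntSeries.hasValueAt_monomialLine_iff _ _ G' (by rw [norm_zero]; exact one_pos), h1, h1]
    exact hg'
  rw [hgF.unique hx0, hg'F.unique hy0, hkey]

/-- **Norm form**: the values of the two frames at the origin have equal norm. [cite: deShalit1987, II.4.12 Remarks (iii)–(iv) (p. 66–67)] -/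
theorem norm_value_origin_eq (hK : IsImaginaryQuadratic K)
    {ι : PadicAlgCl p ≃+* ℂ} {v vbar : HeightOneSpectrum (𝓞 K)}
    (hv : ((p : ℕ) : 𝓞 K) ∈ v.asIdeal) (hvbar : ((p : ℕ) : 𝓞 K) ∈ vbar.asIdeal) (hne : vbar ≠ v)
    (hι : ∀ (w : InfinitePlace K) (d : 𝓞 K), d ∈ v.asIdeal ↔ ‖ι.symm (w.embedding (d : K))‖ < 1)
    {S : Finset (HeightOneSpectrum (𝓞 K))}
    {η : HeckeCharacter K} {w₀ : ℕ} (hw₀ : 0 < w₀) (hη : η.HasInfinityType (fun _ ↦ (w₀ : ℤ)) (fun _ ↦ 0))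
    {lam : HeckeCharacter K} {a b : ℕ} (hba : b ≤ a)
    (hlam : lam.HasInfinityType (fun _ ↦ -(a : ℤ)) (fun _ ↦ (b : ℤ)))
    (hlamu : ∀ w : HeightOneSpectrum (𝓞 K), w ∉ S → w ≠ vbar → lam.IsUnramifiedAt w)
    {κ₁ κ₂ : ZpExtension K p} {γ₁ γ₂ : absoluteGaloisGroup K}
    (hpair : ZpExtension.IsTopGeneratorPair κ₁ κ₂ γ₁ γ₂)
    {Ω δ Ω' δ' : ℂ} {Ωp Ωp' : ℂ_[p]} {G G' : PowerSeries (PowerSeries (PadicComplexInt p))}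
    (hG : IsKatzMeasure₂ ι v vbar S κ₁ κ₂ γ₁ γ₂ lam Ω δ Ωp G)
    (hG' : IsKatzMeasure₂ ι v vbar S κ₁ κ₂ γ₁ γ₂ lam Ω' δ' Ωp' G')
    (hΩ : Ω ≠ 0) (hδ : δ ≠ 0) (hΩp : Ωp ≠ 0) (hΩ' : Ω' ≠ 0) (hδ' : δ' ≠ 0) (hΩp' : Ωp' ≠ 0)
    (hG0 : G ≠ 0) {g g' : ℂ_[p]} (hg : IntSeries.HasValueAt₂ G 0 0 g) (hg' : IntSeries.HasValueAt₂ G' 0 0 g') :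
    ‖g'‖ = ‖g‖ := by
  obtain ⟨hA, hB⟩ := norm_periodRatio_eq_one hK hv hvbar hne hι hw₀ hη hba hlam hlamu hpair hG hG' hΩ hδ hΩp hΩ' hδ' hΩp' hG0
  rw [value_origin_eq_periodRatio_pow_mul hK hv hvbar hne hι hw₀ hη hba hlam hlamu hpair hG hG' hΩ hδ hΩp hΩ' hδ' hΩp' hG0 hg hg',
    norm_mul, norm_mul, norm_pow, norm_pow, hA, hB, one_pow, one_pow, one_mul, one_mul]

end Summit.BirchSwinnertonDyer.BirchSwinnertonDyer.Theorems.PrintCf2.KatzPeriodRigidity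

end
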